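import Summits.HodgeConjecture.HodgeConjecture.Theorems.F0P6cDictConstructorsHead   -- ★ previous part of the same Lines workfile `F0_P6c_DictConstructors` (size-lint split ×3)
import HarnessLib

/-!
# `F0P6cDictConstructors` — ★ RE-HOME of `Lines/F0_P6c_DictConstructors.lean`, PART 3 of 3 (size-lint split; cut at a declaration boundary).

See PART 1 `Theorems/F0P6cDictConstructorsStubs.lean` for the full re-home header and the original module docstring (verbatim there). Namespaces and sections KEPT
(re-opened below exactly as they stand at the cut, with their `open`∕`variable` lines replayed); code bytes = the workfile՚s, docstrings included; options preamble repeated from PART 1.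
HC_CM is proved only modulo the 7 printed citations (2 remaining: hLiu418 = stmt-HodgeConjecture-24832, h413 = stmt-HodgeConjecture-24833) until rung 0 closes; a re-home is count-neutral. -/

set_option autoImplicit false

noncomputable section

namespace Summit.HodgeConjecture.HodgeConjecture.Cruxes.HLiu418.F0P6cDictConstructors
set_option linter.dupNamespace false  -- `Summit.HodgeConjecture.HodgeConjecture.…` BY DESIGN (D-0017)
open CategoryTheory CategoryTheory.Limits AlgebraicGeometry MonoidalCategory CartesianMonoidalCategory
open NumberField IsDedekindDomain MulAction Polynomial
open scoped Matrix MonObj Obj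
open Literature.NumberTheory.GaloisRepresentations
open Literature.NumberTheory.Automorphic Literature.NumberTheory.Automorphic.UnitaryGroup
open Literature.AlgebraicGeometry.ShimuraVarieties.UnitaryCanonicalModel
open Literature.NumberTheory.Automorphic.Liu2021.AppendixC
open Literature.AlgebraicGeometry.Motives (AlgPoints SchemeOver specOver relFrobeniusOver frobeniusTwistOver)
open Literature.AlgebraicGeometry.GroupSchemes (eq_or_etale_of_isHopfIdeal_of_stable)
open Literature.AlgebraicGeometry.GroupSchemes.AffineGroupScheme (Alg quotIncl ptEquiv isoSpecOver ptEquiv_comp ptEquiv_quotIncl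
  exists_comp_quotIncl_eq_iff_le_ker Alg.comap_apply)
open Literature.AlgebraicGeometry.GroupSchemes.GroupSchemeKernel (ker kerι kerLift kerLift_ι)
open Summit.HodgeConjecture.HodgeConjecture.Cruxes.HLiu418.F0P6cIsogenyDictionary (PointDictionary)
universe v


/-! ## §5 ED.-4 GLUE (ED. 3, F0P6c-plan (g3); §1–§4 token-identical): the junction՚s two IN-DATUM derivations

At ED. 4 the HEART letter (`RecordHeartDictionary`) hands `heart_of_carriers` every K ∕ carrier ∕ isogeny ∕ sheet ∕ Hecke row BY NAME from P6a՚s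
`ModuliDatum 𝔇` (fields `block₀.*`, `Line Sub kerF IsEtale quotΩ translΩ quot transl sp smap smap_kerF quot_smap red_quotΩ red_translΩ hecke`;
junction leg GREEN on Defs v0.5b 21b47f99) plus two EXTERNAL rows: `hcover` (★ SHEET-COVER p845161) and `hHFimg`.  The latter is NOT a field of `𝔇`:
(5b) derives it from HEART-FROB′ read on one sheet, `red_quotΩ`, the canonical line (ordinary) and the dichotomy (5a) (supersingular: every
`H : Sub (red y)` is `kerF (red y)`, so ANY line passes through it) — given `Nonempty (Line y)` at supersingular `red y`, the one record-system input
(ref1 (g2) n35) — and (6) `nonempty_line_of_hecke` SUPPLIES that input at every `y` from the `hhecke` row and the ★ record tower (finite Hecke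
orbits, a common deeper level, `π` surjective on `Ω`-points), so ED. 4 needs no datum field for it (LEAD (g2) ruling (b′) 20:50:18Z).  (5a)(5b) are
frame-free (any `P`, `Ω`, `Fr`, `red`); (6) lives in the record frame of §4; no new import.
[cite: Liu2021, Prop. D.8 (3) p. 135, pp. 137–138] [cite: Carayol1986Compositio, §10.3 Prop. p. 211] [cite: Tate1997FiniteFlatGroupSchemes, (3.7)] -/

section EdFourGlue

universe u' v' w'

/-- **(5a) DICHOTOMY ON ABSTRACT CARRIERS** (the (b) bullet of `heart_of_carriers`, exported for ED. 4): with the K-rows of the `w`-block `G₀ x̄`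
(unit component `U`, monogenic coordinate `θU`, `hrkF`, `hpts`, `hsimple`) and the DOWNSTAIRS IDENTIFICATION `subEquiv ∕ hkerF ∕ hIsEtale`,
every `H : Sub x̄` is the Frobenius kernel `kerF x̄` or étale — ★ (K-b) `eq_kerFI_or_idealIsEtale_of_isAdm` pulled back along `subEquiv x̄`.
At a supersingular `x̄` (no étale `H`) this says `Sub x̄ = {kerF x̄}`. [cite: Tate1997FiniteFlatGroupSchemes, (3.7)] [cite: Liu2021, p. 137] -/
theorem eq_kerF_or_isEtale_of_carriers
    {k₀ : Type} [Field k₀] [IsAlgClosed k₀] (p f : ℕ) [Fact p.Prime] [CharP k₀ p] [ExpChar k₀ p]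
    {P : Type v'} {σO : Type w'} (G₀ : P → SchemeOver k₀) [∀ x, GrpObj (G₀ x)] [∀ x, IsAffine (G₀ x).left] [∀ x, IsFinite (G₀ x).hom]
    (β₀ : ∀ x, σO → (G₀ x ⟶ G₀ x)) (hβ₀ : ∀ x a, IsMonHom (β₀ x a))
    (U : P → SchemeOver k₀) [∀ x, GrpObj (U x)] [∀ x, IsAffine (U x).left] (jU : ∀ x, U x ⟶ G₀ x)
    (hU : ∀ x, IsMonHom (jU x) ∧ IsOpenImmersion (jU x).left ∧ IsClosedImmersion (jU x).left ∧ ConnectedSpace ↥(U x).left)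
    (NU : P → ℕ) (θU : ∀ x, (k₀[X] ⧸ Ideal.span {(X : k₀[X]) ^ (p ^ NU x)}) ≃ₐ[k₀] Alg (U x))
    (hrkF : ∀ x, Module.finrank k₀ (Alg (G₀ x) ⧸ kerFI p f (G₀ x)) = p ^ f)
    (hpts : ∀ x, Nat.card (𝟙_ (SchemeOver k₀) ⟶ G₀ x) = 1 ∨ Nat.card (𝟙_ (SchemeOver k₀) ⟶ G₀ x) = p ^ f)
    (hsimple : ∀ x, ∀ Λ : Subgroup (𝟙_ (SchemeOver k₀) ⟶ G₀ x), (∀ a, ∀ g ∈ Λ, g ≫ β₀ x a ∈ Λ) → Λ = ⊥ ∨ Λ = ⊤)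
    (Sub : P → Type u') (subEquiv : ∀ x, Sub x ≃ AdmSub (G₀ x) (β₀ x) (p ^ f))
    (kerF : ∀ x, Sub x) (hkerF : ∀ x, (subEquiv x (kerF x)).1 = kerFI p f (G₀ x))
    (IsEtale : ∀ {x : P}, Sub x → Prop) (hIsEtale : ∀ x (H : Sub x), IsEtale H ↔ IdealIsEtale (G₀ x) (subEquiv x H).1)
    (x : P) (H : Sub x) : H = kerF x ∨ IsEtale H := by
  rcases eq_kerFI_or_idealIsEtale_of_isAdm p f (G₀ x) (β₀ x) (hβ₀ x) (U x) (jU x) (hU x) (NU x) (θU x) (hrkF x) (hpts x)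
      (hsimple x) (subEquiv x H).1 (subEquiv x H).2 with h | h
  · refine Or.inl ((subEquiv x).injective (Subtype.ext ?_))
    rw [hkerF x]
    exact h
  · exact Or.inr ((hIsEtale x H).mpr h)

/-- **(5b) THE EXTERNAL ROW `hHFimg` OF `heart_of_carriers` FROM HEART-FROB′ AND A LINE THROUGH `kerF`** (frame-free).  Given the dichotomy (5a)
`hdich`, the canonical line `hKb4` (ordinary points), a line at every supersingular reduction `hne`, `hred_quotΩ`, and HEART-FROB′ read on one
sheet `hHF : ∀ y L, sp y L = kerF (red y) → red (quotΩ y L) = Fr (red y)` (P6a: `(𝔇.HeartFrob σ hσ y L h).trans (hFrRed e y).symm`), the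
canonical quotient at `red y` IS the Frobenius point: `quot₀ (red y) (kerF (red y)) = Fr (red y)` — Liu D.8 (3) on the image of the reading.
[cite: Liu2021, Prop. D.8 (3) p. 135, pp. 137–138] [cite: Carayol1986Compositio, §10.3 Prop. p. 211] -/
theorem quot_kerF_eq_of_lines
    {Ω : Type w'} {P : Type v'} (Fr : P → P) (red : Ω → P)
    (Line : Ω → Type u') (Sub : P → Type u') (kerF : ∀ x, Sub x) (IsEtale : ∀ {x : P}, Sub x → Prop)
    (quotΩ : ∀ y, Line y → Ω) (quot₀ : ∀ x, Sub x → P) (sp : ∀ y, Line y → Sub (red y))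
    (hred_quotΩ : ∀ y L, red (quotΩ y L) = quot₀ (red y) (sp y L))
    (hdich : ∀ x (H : Sub x), H = kerF x ∨ IsEtale H)
    (hKb4 : ∀ y, (∃ H : Sub (red y), IsEtale H) →
      ∃ L₀ : Line y, sp y L₀ = kerF (red y) ∧ ∀ L : Line y, sp y L = kerF (red y) → L = L₀)
    (hne : ∀ y, (∀ H : Sub (red y), ¬ IsEtale H) → Nonempty (Line y))
    (hHF : ∀ y (L : Line y), sp y L = kerF (red y) → red (quotΩ y L) = Fr (red y))
    (y : Ω) : quot₀ (red y) (kerF (red y)) = Fr (red y) := by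
  -- a line through `kerF (red y)`: the canonical one (ordinary) or any one (supersingular)
  obtain ⟨L, hL⟩ : ∃ L : Line y, sp y L = kerF (red y) := by
    by_cases h : ∃ H : Sub (red y), IsEtale H
    · obtain ⟨L₀, hL₀, -⟩ := hKb4 y h
      exact ⟨L₀, hL₀⟩
    · obtain ⟨L⟩ := hne y fun H hH => h ⟨H, hH⟩
      exact ⟨L, (hdich _ (sp y L)).resolve_right fun hH => h ⟨_, hH⟩⟩
  rw [← hL, ← hred_quotΩ y L]
  exact hHF y L hL

open Literature.AlgebraicGeometry.Motives (SchemeOver.exists_algPoints_comp_eq_of_surjective SchemeOver.surjective_left_of_forall_algPoints) in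
/-- **(6) A LINE AT EVERY POINT, FROM THE HECKE ROW** (the (b′) supplier of the ED.-4 external `hne`, BY NAME from the ★ record tower):
the `hhecke` binder of `heart_of_carriers` (= P6a `𝔇.hecke`) gives, at any deeper level `N′ ≤ Kc` carrying representatives of the two
Hecke orbits, a bijection `Kc t₁ Kc ⁄ Kc ≃ Line (π x′)`; the orbits are finite (★ `isHeckeTriple_top_of_isCompact_isOpen` +
★ `finite_orbit_quotient`), such an `N′` exists (★ `C5.SmallLevel.exists_normal_le_forall_heckeLE`), and `π : M_{N′} → M_{Kc}` is
surjective on `Ω`-points (★ `map_complexPoints_surjective` ⇒ ★ `surjective_left_of_forall_algPoints` ⇒ ★ `exists_algPoints_comp_eq_of_surjective`),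
so every `y` is some `π x′` and the coset of `t₁` itself is a line over `y`. [cite: Liu2021, p. 137] [cite: Milne2005ShimuraVarieties, Rem. 5.29 (a) p. 65] -/
theorem nonempty_line_of_hecke
    (F : Type) [Field F] [NumberField F] [IsCMField F] (ι₁ : F →+* ℂ)
    (Jstar : Matrix (Fin 2) (Fin 2) F)
    (K₀ : C5.OpenCompactSubgroup ↥(finAdelic ↥(maximalRealSubfield F) F (IsCMField.complexConj F) 2 Jstar))
    (S : RecordSystemGS F Jstar ι₁ K₀) (hU7ₛ : S.HeckeTranslateDefinedOver)
    (hJ : (Jstar.map (IsCMField.complexConj F))ᵀ = Jstar) (hJu : IsUnit Jstar)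
    (w : HeightOneSpectrum (𝓞 F)) (hw : (IsCMField.complexConj F) • w ≠ w)
    (Kc : C5.SmallLevel K₀)
    (Line : AlgPoints (S.M.obj Kc) (AlgebraicClosure (w.adicCompletion F)) → Type u')
    (quotΩ : ∀ y, Line y → AlgPoints (S.M.obj Kc) (AlgebraicClosure (w.adicCompletion F)))
    (translΩ : AlgPoints (S.M.obj Kc) (AlgebraicClosure (w.adicCompletion F)) →
      AlgPoints (S.M.obj Kc) (AlgebraicClosure (w.adicCompletion F)))
    (hhecke : ∀ (N' : C5.SmallLevel K₀) (hN'Kc : N' ≤ Kc)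
      (rc₁ : orbit (Kc.1.1 : Subgroup ↥(finAdelic ↥(maximalRealSubfield F) F (IsCMField.complexConj F) 2 Jstar))
           ((UnitaryGroup.heckeElementAt ↥(maximalRealSubfield F) F (IsCMField.complexConj F) 2 Jstar
               (⟨w, rfl⟩ : UnitaryGroup.PlacesOver F (w.under (𝓞 ↥(maximalRealSubfield F))))
               (IsCMField.complexConj_ne_one F) hJ hw (UnitaryGroup.isUnit_placeForm Jstar hJu w) (HeckeCharacter.uniformizer F w) 1 :
             ↥(finAdelic ↥(maximalRealSubfield F) F (IsCMField.complexConj F) 2 Jstar)) :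
             ↥(finAdelic ↥(maximalRealSubfield F) F (IsCMField.complexConj F) 2 Jstar) ⧸
               (Kc.1.1 : Subgroup ↥(finAdelic ↥(maximalRealSubfield F) F (IsCMField.complexConj F) 2 Jstar))) →
         ↥(finAdelic ↥(maximalRealSubfield F) F (IsCMField.complexConj F) 2 Jstar)),
      (∀ β, ((rc₁ β : ↥(finAdelic ↥(maximalRealSubfield F) F (IsCMField.complexConj F) 2 Jstar)) :
          ↥(finAdelic ↥(maximalRealSubfield F) F (IsCMField.complexConj F) 2 Jstar) ⧸
            (Kc.1.1 : Subgroup ↥(finAdelic ↥(maximalRealSubfield F) F (IsCMField.complexConj F) 2 Jstar))) = β.1) →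
      ∀ (hrcN₁ : ∀ β, C5.HeckeLE (rc₁ β) N' Kc)
        (rc₂ : orbit (Kc.1.1 : Subgroup ↥(finAdelic ↥(maximalRealSubfield F) F (IsCMField.complexConj F) 2 Jstar))
           ((UnitaryGroup.heckeElementAt ↥(maximalRealSubfield F) F (IsCMField.complexConj F) 2 Jstar
               (⟨w, rfl⟩ : UnitaryGroup.PlacesOver F (w.under (𝓞 ↥(maximalRealSubfield F))))
               (IsCMField.complexConj_ne_one F) hJ hw (UnitaryGroup.isUnit_placeForm Jstar hJu w) (HeckeCharacter.uniformizer F w) 2 :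
             ↥(finAdelic ↥(maximalRealSubfield F) F (IsCMField.complexConj F) 2 Jstar)) :
             ↥(finAdelic ↥(maximalRealSubfield F) F (IsCMField.complexConj F) 2 Jstar) ⧸
               (Kc.1.1 : Subgroup ↥(finAdelic ↥(maximalRealSubfield F) F (IsCMField.complexConj F) 2 Jstar))) →
         ↥(finAdelic ↥(maximalRealSubfield F) F (IsCMField.complexConj F) 2 Jstar)),
      (∀ β, ((rc₂ β : ↥(finAdelic ↥(maximalRealSubfield F) F (IsCMField.complexConj F) 2 Jstar)) :
          ↥(finAdelic ↥(maximalRealSubfield F) F (IsCMField.complexConj F) 2 Jstar) ⧸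
            (Kc.1.1 : Subgroup ↥(finAdelic ↥(maximalRealSubfield F) F (IsCMField.complexConj F) 2 Jstar))) = β.1) →
      ∀ (hrcN₂ : ∀ β, C5.HeckeLE (rc₂ β) N' Kc),
      ∀ x' : AlgPoints (S.M.obj N') (AlgebraicClosure (w.adicCompletion F)),
        ∃ e : (orbit (Kc.1.1 : Subgroup ↥(finAdelic ↥(maximalRealSubfield F) F (IsCMField.complexConj F) 2 Jstar))
           ((UnitaryGroup.heckeElementAt ↥(maximalRealSubfield F) F (IsCMField.complexConj F) 2 Jstar
               (⟨w, rfl⟩ : UnitaryGroup.PlacesOver F (w.under (𝓞 ↥(maximalRealSubfield F))))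
               (IsCMField.complexConj_ne_one F) hJ hw (UnitaryGroup.isUnit_placeForm Jstar hJu w) (HeckeCharacter.uniformizer F w) 1 :
             ↥(finAdelic ↥(maximalRealSubfield F) F (IsCMField.complexConj F) 2 Jstar)) :
             ↥(finAdelic ↥(maximalRealSubfield F) F (IsCMField.complexConj F) 2 Jstar) ⧸
               (Kc.1.1 : Subgroup ↥(finAdelic ↥(maximalRealSubfield F) F (IsCMField.complexConj F) 2 Jstar)))) ≃
            Line (AlgPoints.map (S.M.map (homOfLE hN'Kc)) x'),
          (∀ β, AlgPoints.map (recordHeckeTranslateGS S hU7ₛ (rc₁ β) N' Kc (hrcN₁ β)) x' =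
              quotΩ (AlgPoints.map (S.M.map (homOfLE hN'Kc)) x') (e β)) ∧
          ∀ β₂, AlgPoints.map (recordHeckeTranslateGS S hU7ₛ (rc₂ β₂) N' Kc (hrcN₂ β₂)) x' =
              translΩ (AlgPoints.map (S.M.map (homOfLE hN'Kc)) x'))
    (y : AlgPoints (S.M.obj Kc) (AlgebraicClosure (w.adicCompletion F))) : Nonempty (Line y) := by
  classical
  -- the two Hecke orbits are finite (compact open level ⇒ Hecke pair)
  haveI := Literature.NumberTheory.Automorphic.isHeckeTriple_top_of_isCompact_isOpen
    (Kc.1.1 : Subgroup ↥(finAdelic ↥(maximalRealSubfield F) F (IsCMField.complexConj F) 2 Jstar)) Kc.1.2.2 Kc.1.2.1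
  haveI := (Literature.NumberTheory.Automorphic.finite_orbit_quotient
    (Kc.1.1 : Subgroup ↥(finAdelic ↥(maximalRealSubfield F) F (IsCMField.complexConj F) 2 Jstar))
    (UnitaryGroup.heckeElementAt ↥(maximalRealSubfield F) F (IsCMField.complexConj F) 2 Jstar
      (⟨w, rfl⟩ : UnitaryGroup.PlacesOver F (w.under (𝓞 ↥(maximalRealSubfield F))))
      (IsCMField.complexConj_ne_one F) hJ hw (UnitaryGroup.isUnit_placeForm Jstar hJu w) (HeckeCharacter.uniformizer F w) 1)).fintype
  haveI := (Literature.NumberTheory.Automorphic.finite_orbit_quotient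
    (Kc.1.1 : Subgroup ↥(finAdelic ↥(maximalRealSubfield F) F (IsCMField.complexConj F) 2 Jstar))
    (UnitaryGroup.heckeElementAt ↥(maximalRealSubfield F) F (IsCMField.complexConj F) 2 Jstar
      (⟨w, rfl⟩ : UnitaryGroup.PlacesOver F (w.under (𝓞 ↥(maximalRealSubfield F))))
      (IsCMField.complexConj_ne_one F) hJ hw (UnitaryGroup.isUnit_placeForm Jstar hJu w) (HeckeCharacter.uniformizer F w) 2)).fintype
  -- a common deeper level carrying representatives of both orbits
  obtain ⟨N', hN'Kc, -, hγ⟩ := C5.SmallLevel.exists_normal_le_forall_heckeLE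
    (Finset.univ.image (fun β : orbit (Kc.1.1 : Subgroup ↥(finAdelic ↥(maximalRealSubfield F) F (IsCMField.complexConj F) 2 Jstar))
        ((UnitaryGroup.heckeElementAt ↥(maximalRealSubfield F) F (IsCMField.complexConj F) 2 Jstar
            (⟨w, rfl⟩ : UnitaryGroup.PlacesOver F (w.under (𝓞 ↥(maximalRealSubfield F))))
            (IsCMField.complexConj_ne_one F) hJ hw (UnitaryGroup.isUnit_placeForm Jstar hJu w) (HeckeCharacter.uniformizer F w) 1 :
          ↥(finAdelic ↥(maximalRealSubfield F) F (IsCMField.complexConj F) 2 Jstar)) :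
          ↥(finAdelic ↥(maximalRealSubfield F) F (IsCMField.complexConj F) 2 Jstar) ⧸
            (Kc.1.1 : Subgroup ↥(finAdelic ↥(maximalRealSubfield F) F (IsCMField.complexConj F) 2 Jstar))) => Quotient.out β.1) ∪
      Finset.univ.image (fun β : orbit (Kc.1.1 : Subgroup ↥(finAdelic ↥(maximalRealSubfield F) F (IsCMField.complexConj F) 2 Jstar))
        ((UnitaryGroup.heckeElementAt ↥(maximalRealSubfield F) F (IsCMField.complexConj F) 2 Jstar
            (⟨w, rfl⟩ : UnitaryGroup.PlacesOver F (w.under (𝓞 ↥(maximalRealSubfield F))))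
            (IsCMField.complexConj_ne_one F) hJ hw (UnitaryGroup.isUnit_placeForm Jstar hJu w) (HeckeCharacter.uniformizer F w) 2 :
          ↥(finAdelic ↥(maximalRealSubfield F) F (IsCMField.complexConj F) 2 Jstar)) :
          ↥(finAdelic ↥(maximalRealSubfield F) F (IsCMField.complexConj F) 2 Jstar) ⧸
            (Kc.1.1 : Subgroup ↥(finAdelic ↥(maximalRealSubfield F) F (IsCMField.complexConj F) 2 Jstar))) => Quotient.out β.1)) Kc
  -- `π : M_{N′} → M_{Kc}` is surjective on `Ω`-points
  letI : Algebra F ℂ := ι₁.toAlgebra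
  haveI : IsProper (S.M.obj N').hom := (S.projective N').isProper
  haveI : IsProper (S.M.obj Kc).hom := (S.projective Kc).isProper
  haveI : UniversallyClosed (S.M.map (homOfLE hN'Kc)).left := by
    haveI : UniversallyClosed ((S.M.map (homOfLE hN'Kc)).left ≫ (S.M.obj Kc).hom) := by rw [Over.w]; infer_instance
    exact UniversallyClosed.of_comp_of_isSeparated _ (S.M.obj Kc).hom
  haveI : LocallyOfFiniteType (S.M.map (homOfLE hN'Kc)).left := by
    haveI : LocallyOfFiniteType ((S.M.map (homOfLE hN'Kc)).left ≫ (S.M.obj Kc).hom) := by rw [Over.w]; infer_instance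
    exact locallyOfFiniteType_of_comp _ (S.M.obj Kc).hom
  haveI : Surjective (S.M.map (homOfLE hN'Kc)).left :=
    SchemeOver.surjective_left_of_forall_algPoints ℂ (S.M.map (homOfLE hN'Kc)) fun P => by
      obtain ⟨Q, hQ⟩ := S.map_complexPoints_surjective (homOfLE hN'Kc) P
      exact ⟨Q, hQ⟩
  obtain ⟨x', hx'⟩ := SchemeOver.exists_algPoints_comp_eq_of_surjective (AlgebraicClosure (w.adicCompletion F))
    (S.M.map (homOfLE hN'Kc)) y
  -- the Hecke row at `x′`: the coset of `t₁` itself is a line over `π x′ = y`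
  obtain ⟨e, -, -⟩ := hhecke N' hN'Kc _ (fun β => Quotient.out_eq β.1)
    (fun β => hγ _ (Finset.mem_union_left _ (Finset.mem_image_of_mem _ (Finset.mem_univ β))))
    _ (fun β => Quotient.out_eq β.1)
    (fun β => hγ _ (Finset.mem_union_right _ (Finset.mem_image_of_mem _ (Finset.mem_univ β)))) x'
  have hy : AlgPoints.map (S.M.map (homOfLE hN'Kc)) x' = y := hx'
  exact hy ▸ ⟨e ⟨_, mem_orbit_self _⟩⟩

end EdFourGlue

end Summit.HodgeConjecture.HodgeConjecture.Cruxes.HLiu418.F0P6cDictConstructors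

end
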